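import Literature.GroupTheory.CombinatorialGroupTheory.RandomSclFreeGroupTripodAssembly
import Literature.GroupTheory.CombinatorialGroupTheory.RandomSclFreeGroupRankMatching
import Literature.GroupTheory.CombinatorialGroupTheory.RandomSclFreeGroupTripodPatterns
import HarnessLib

/-!
# Random rigidity of scl (Calegari–Walker 2013): proofs, part 19 — the tripod bound for `cl`

D. Calegari, A. Walker, *Random rigidity in the free group*, Geom. Topol. 17 (2013)
[CalegariWalker2013], §4.2–§4.3 (Lemma 4.7 and the proof of Prop. 4.2), deterministic form.
For a reduced word `v` (letters `vg : ℕ → Fin k × Bool`) let `Cor` be the set of rigid tripod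
copies with corners in `[lo, hi]` (see `RandomSclFreeGroupTripodPatterns`). We glue their
prongs by rank along the joint involution `(a, b) ↦ (b + h, a − h)` (`exists_rankMatching`),
bound the number of unglued prongs and the number of incoming sides over a letter by the
pattern counts, and feed the result into `four_mul_cl_pow_le_of_gluedTripods`.

* **`not_window_self_inverse`** — a window of a reduced word is not its own inverse (so the
  joint involution has no fixed site).
* **`sites_good_of_windows`** — the three sites of a copy are good.
* **`four_mul_cl_pow_le_of_patternCounts`** — the deterministic bound
  `4 cl(v^{N'}) + (3h − 1) Tlow ≤ N' n + 2 + (h + 1) Uup` in terms of uniform two-sided bounds on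
  the counts of the reduced words of lengths `2h + 2` and `h + 2` (inside: at least
  `(hi + 1 − lo) (2k−2)² B⁻ (2k−2)² A⁻` copies, at most `(2k−2)⁴ B⁺ A⁺` copies with a given
  corner, hence at most `N' = 3h (2k−2)⁴ B⁺ A⁺` incoming sides over a letter, and at most `Uup`
  unglued prongs — `3 · #{free corners}` prongs sit at each site, and the partner site of an inner
  site is again a good site in range).
-/

namespace Literature.GroupTheory.CombinatorialGroupTheory

section TripodCounts

open Finset

/-- **A window of a reduced word is not its own inverse** (read backwards): otherwise its middle
letter would equal its own inverse, or its two middle letters would cancel.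
[cite: CalegariWalker2013, §4.2 ("these segments cannot overlap")] -/
theorem not_window_self_inverse {k : ℕ} (vg : ℕ → Fin k × Bool) (n h : ℕ) (hh : 1 ≤ h)
    (hred : ∀ i, i + 1 < n → vg (i + 1) ≠ ((vg i).1, !(vg i).2)) (b : ℕ) (hbn : b + h ≤ n)
    (hW : ∀ q, q < h → vg (b + (h - 1 - q)) = ((vg (b + q)).1, !(vg (b + q)).2)) : False := by
  rcases Nat.even_or_odd h with ⟨m, hm⟩ | ⟨m, hm⟩
  · -- `h = 2m`: the letters at `b + m - 1` and `b + m` cancel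
    have hm1 : 1 ≤ m := by omega
    have e := hW m (by omega)
    have e1 : b + (h - 1 - m) = b + m - 1 := by omega
    rw [e1] at e
    have hr := hred (b + m - 1) (by omega)
    have e2 : b + m - 1 + 1 = b + m := by omega
    rw [e2] at hr
    exact hr ((eq_inv_letter_comm _ _).mp e)
  · -- `h = 2m + 1`: the letter at `b + m` is its own inverse
    have e := hW m (by omega)
    have e1 : b + (h - 1 - m) = b + m := by omega
    rw [e1] at e
    have h2 := congrArg Prod.snd e
    simp only at h2
    exact Bool.not_ne_self _ h2.symm

/-- **The sites of a rigid copy are good.** If `(c₀, c₁, c₂)` is a rigid tripod copy (three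
window conditions) with corners in `[h, n)`, then at each of its three sites `(cᵢ, c_{i+2})` the
corner letters are compatible: `vg cᵢ ≠ (vg (c_{i+2} − 1))⁻¹`. [cite: CalegariWalker2013, Lemma 4.4] -/
theorem sites_good_of_windows {k : ℕ} (vg : ℕ → Fin k × Bool) (n h : ℕ) (hh : 1 ≤ h)
    (hred : ∀ i, i + 1 < n → vg (i + 1) ≠ ((vg i).1, !(vg i).2))
    (c₀ c₁ c₂ : ℕ) (h₀ : h ≤ c₀) (h₀n : c₀ < n) (h₁ : h ≤ c₁) (h₁n : c₁ < n) (h₂ : h ≤ c₂)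
    (h₂n : c₂ < n)
    (hW0 : ∀ q, q < h → vg (c₂ + (h - 1 - q)) = ((vg (c₀ - h + q)).1, !(vg (c₀ - h + q)).2))
    (hW1 : ∀ q, q < h → vg (c₀ + (h - 1 - q)) = ((vg (c₁ - h + q)).1, !(vg (c₁ - h + q)).2))
    (hW2 : ∀ q, q < h → vg (c₁ + (h - 1 - q)) = ((vg (c₂ - h + q)).1, !(vg (c₂ - h + q)).2)) :
    vg c₀ ≠ ((vg (c₂ - 1)).1, !(vg (c₂ - 1)).2) ∧ vg c₁ ≠ ((vg (c₀ - 1)).1, !(vg (c₀ - 1)).2) ∧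
      vg c₂ ≠ ((vg (c₁ - 1)).1, !(vg (c₁ - 1)).2) :=
  ⟨site_good_of_corners vg n h hh hred c₀ c₂ c₁ h₁ h₁n h₂ hW1 hW2,
    site_good_of_corners vg n h hh hred c₁ c₀ c₂ h₂ h₂n h₀ hW2 hW0,
    site_good_of_corners vg n h hh hred c₂ c₁ c₀ h₀ h₀n h₁ hW0 hW1⟩

/-- **The tripod bound for commutator length (CW Prop. 4.2, deterministic form).** Let `v` be a
reduced word of length `n` in the commutator subgroup with letters `vg`, `h = ℓ + 1 ≥ 1` a prong
length, `[lo, hi]` a range of corners with `h + 1 ≤ lo`, `hi + h < n`. Suppose every reduced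
word of length `2h + 2` occurs between `Amin` and `Amax` times at the positions `c − h − 1`,
`c ∈ [lo, hi]`, and every reduced word of length `h + 2` occurs between `Bmin` and `Bmax` times
at the positions `b − 1`, `b ∈ [lo, hi]`, and at most `Bmax` times at the positions `a − h − 1`,
`a ∈ [lo, hi]`. Then, with `q = (2k−2)²`, `N' = 3h · qBmax · qAmax`,
`Tlow = (hi + 1 − lo) · qBmin · qAmin` and
`Uup = 3q ((Amax − Amin)(hi + 1 − lo) qBmax + 2h Amax qBmax)`:
`4 cl(v^{N'}) + (3h − 1) Tlow ≤ N' n + 2 + (h + 1) Uup`.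
(Rigid tripod copies with corners in `[lo, hi]`, glued by rank along the joint involution;
`four_mul_cl_pow_le_of_gluedTripods`.) [cite: CalegariWalker2013, Prop. 4.2 (proof, §4.3) and
Lemma 4.7] -/
theorem four_mul_cl_pow_le_of_patternCounts {k n : ℕ} (v : Fin n → Fin k × Bool)
    (hvc : FreeGroup.mk (List.ofFn v) ∈ commutator (FreeGroup (Fin k)))
    (vg : ℕ → Fin k × Bool) (hvg : ∀ i (hi : i < n), vg i = v ⟨i, hi⟩)
    (hred : ∀ i, i + 1 < n → vg (i + 1) ≠ ((vg i).1, !(vg i).2))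
    (ℓ lo hi : ℕ) (hlo : ℓ + 2 ≤ lo) (hhi : hi + (ℓ + 1) < n)
    (Amin Amax Bmin Bmax : ℕ)
    (hA : ∀ τ : ℕ → Fin k × Bool,
      (∀ i, i + 1 < 2 * (ℓ + 1) + 2 → τ (i + 1) ≠ ((τ i).1, !(τ i).2)) →
      Amin ≤ ((Finset.Icc lo hi).filter fun c =>
        ∀ i, i < 2 * (ℓ + 1) + 2 → vg (c - (ℓ + 1) - 1 + i) = τ i).card ∧
      ((Finset.Icc lo hi).filter fun c =>
        ∀ i, i < 2 * (ℓ + 1) + 2 → vg (c - (ℓ + 1) - 1 + i) = τ i).card ≤ Amax)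
    (hB : ∀ ρ : ℕ → Fin k × Bool,
      (∀ j, j + 1 < (ℓ + 1) + 2 → ρ (j + 1) ≠ ((ρ j).1, !(ρ j).2)) →
      Bmin ≤ ((Finset.Icc lo hi).filter fun b =>
        ∀ j, j < (ℓ + 1) + 2 → vg (b - 1 + j) = ρ j).card ∧
      ((Finset.Icc lo hi).filter fun b => ∀ j, j < (ℓ + 1) + 2 → vg (b - 1 + j) = ρ j).card
        ≤ Bmax)
    (hB' : ∀ ρ : ℕ → Fin k × Bool,
      (∀ j, j + 1 < (ℓ + 1) + 2 → ρ (j + 1) ≠ ((ρ j).1, !(ρ j).2)) →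
      ((Finset.Icc lo hi).filter fun a =>
        ∀ j, j < (ℓ + 1) + 2 → vg (a - (ℓ + 1) - 1 + j) = ρ j).card ≤ Bmax) :
    4 * commutatorLength (FreeGroup.mk (List.ofFn v) ^
        (3 * (ℓ + 1) * (((2 * k - 2) * (2 * k - 2) * Bmax) * ((2 * k - 2) * (2 * k - 2) * Amax)))) +
      (3 * (ℓ + 1) - 1) *
        ((hi + 1 - lo) * ((2 * k - 2) * (2 * k - 2) * Bmin) * ((2 * k - 2) * (2 * k - 2) * Amin)) ≤
    (3 * (ℓ + 1) * (((2 * k - 2) * (2 * k - 2) * Bmax) * ((2 * k - 2) * (2 * k - 2) * Amax))) * n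
      + 2 + ((ℓ + 1) + 1) * (3 * ((2 * k - 2) * (2 * k - 2)) *
        ((Amax - Amin) * ((hi + 1 - lo) * ((2 * k - 2) * (2 * k - 2) * Bmax)) +
          Amax * (2 * (ℓ + 1) * ((2 * k - 2) * (2 * k - 2) * Bmax)))) := by
  classical
  set h := ℓ + 1 with hh
  have hh1 : 1 ≤ h := by omega
  -- abbreviations for the numerical constants
  set qq := (2 * k - 2) * (2 * k - 2) with hqq
  set NAmax := qq * Amax with hNAmax
  set NAmin := qq * Amin with hNAmin
  set GBmax := qq * Bmax with hGBmax
  set GBmin := qq * Bmin with hGBmin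
  -- ### the predicates
  let W0 : ℕ → ℕ → Prop := fun a b =>
    ∀ q, q < h → vg (b + (h - 1 - q)) = ((vg (a - h + q)).1, !(vg (a - h + q)).2)
  let R0 : ℕ → ℕ → Prop := fun a b => vg (a - h - 1) ≠ ((vg (b + h)).1, !(vg (b + h)).2)
  let G3 : ℕ → ℕ → Prop := fun a b => vg a ≠ ((vg (b - 1)).1, !(vg (b - 1)).2)
  -- good sites over `a`, and free corners over a site
  let GoodB : ℕ → Finset ℕ := fun a => (Finset.Icc lo hi).filter fun b => W0 a b ∧ R0 a b ∧ G3 a b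
  let PatSet : ℕ → ℕ → Finset ℕ := fun a b => (Finset.Icc lo hi).filter fun c =>
    W0 c a ∧ W0 b c ∧ R0 c a ∧ R0 b c
  -- their bounds
  have hPat : ∀ a b, lo ≤ a → a ≤ hi → lo ≤ b → b ≤ hi → G3 a b →
      NAmin ≤ (PatSet a b).card ∧ (PatSet a b).card ≤ NAmax := by
    intro a b ha ha' hb hb' hG
    exact card_patSet_bounds vg n h hh1 hred lo hi (by omega) hhi Amin Amax hA a b (by omega)
      (by omega) (by omega) (by omega) hG
  have hGoodB : ∀ a, lo ≤ a → a ≤ hi →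
      GBmin ≤ (GoodB a).card ∧ (GoodB a).card ≤ GBmax := by
    intro a ha ha'
    exact card_goodB_bounds vg n h hh1 hred lo hi (by omega) hhi Bmin Bmax hB a (by omega)
      (by omega)
  have hGoodA : ∀ b, lo ≤ b → b ≤ hi →
      ((Finset.Icc lo hi).filter fun a => W0 a b ∧ R0 a b ∧ G3 a b).card ≤ GBmax := by
    intro b hb hb'
    exact card_goodA_le vg n h hh1 hred lo hi (by omega) (by omega) Bmax hB' b (by omega)
      (by omega)
  -- ### the rigid copies
  set Cor : Finset (ℕ × ℕ × ℕ) := ((Finset.Icc lo hi) ×ˢ ((Finset.Icc lo hi) ×ˢ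
    (Finset.Icc lo hi))).filter fun t => (W0 t.1 t.2.2 ∧ W0 t.2.1 t.1 ∧ W0 t.2.2 t.2.1) ∧
      (R0 t.1 t.2.2 ∧ R0 t.2.1 t.1 ∧ R0 t.2.2 t.2.1) with hCor
  have hmemCor : ∀ t, t ∈ Cor ↔ ((lo ≤ t.1 ∧ t.1 ≤ hi) ∧ (lo ≤ t.2.1 ∧ t.2.1 ≤ hi) ∧
      (lo ≤ t.2.2 ∧ t.2.2 ≤ hi)) ∧ (W0 t.1 t.2.2 ∧ W0 t.2.1 t.1 ∧ W0 t.2.2 t.2.1) ∧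
      (R0 t.1 t.2.2 ∧ R0 t.2.1 t.1 ∧ R0 t.2.2 t.2.1) := by
    intro t
    rw [hCor, Finset.mem_filter, Finset.mem_product, Finset.mem_product, Finset.mem_Icc,
      Finset.mem_Icc, Finset.mem_Icc]
  -- the sites of a copy are good
  have hG3 : ∀ t, t ∈ Cor → G3 t.1 t.2.2 ∧ G3 t.2.1 t.1 ∧ G3 t.2.2 t.2.1 := by
    intro t ht
    obtain ⟨⟨h0, h1, h2⟩, ⟨w0, w1, w2⟩, -⟩ := (hmemCor t).mp ht
    exact sites_good_of_windows vg n h hh1 hred t.1 t.2.1 t.2.2 (by omega) (by omega) (by omega)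
      (by omega) (by omega) (by omega) w0 w1 w2
  -- membership of a permuted triple: `(a, c, b) ∈ Cor` iff `b` is a good site over `a` in
  -- range and `c` is a free corner over `(a, b)`
  have hmem_acb : ∀ a b c, lo ≤ a → a ≤ hi → lo ≤ b → b ≤ hi → W0 a b → R0 a b →
      ((a, c, b) ∈ Cor ↔ c ∈ PatSet a b) := by
    intro a b c ha ha' hb hb' hW hR
    rw [hmemCor]
    simp only [PatSet, Finset.mem_filter, Finset.mem_Icc]
    tauto
  set T := Cor.card with hT
  -- ### the lower bound on the number of copies
  have hTlow : (hi + 1 - lo) * GBmin * NAmin ≤ T := by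
    -- the triples `⟨a, b, c⟩` with `b` good over `a` and `c` free over `(a, b)` inject into `Cor`
    set Sig := (Finset.Icc lo hi).sigma fun a => (GoodB a).sigma fun b => PatSet a b with hSig
    have hcard : Sig.card = ∑ a ∈ Finset.Icc lo hi, ∑ b ∈ GoodB a, (PatSet a b).card := by
      rw [hSig, Finset.card_sigma]
      refine Finset.sum_congr rfl fun a _ => ?_
      rw [Finset.card_sigma]
    have hinj : Sig.card ≤ T := by
      refine Finset.card_le_card_of_injOn (fun x => (x.1, x.2.2, x.2.1)) ?_ ?_
      · intro x hx
        rw [Finset.mem_coe, hSig, Finset.mem_sigma, Finset.mem_sigma] at hx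
        obtain ⟨ha, hb, hc⟩ := hx
        rw [Finset.mem_Icc] at ha
        simp only [GoodB, Finset.mem_filter, Finset.mem_Icc] at hb
        rw [Finset.mem_coe]
        exact (hmem_acb x.1 x.2.1 x.2.2 ha.1 ha.2 hb.1.1 hb.1.2 hb.2.1 hb.2.2.1).mpr hc
      · intro x _ y _ hxy
        simp only [Prod.mk.injEq] at hxy
        obtain ⟨e1, e2, e3⟩ := hxy
        exact Sigma.ext e1 (heq_of_eq (Sigma.ext e3 (heq_of_eq e2)))
    have hsum : (hi + 1 - lo) * GBmin * NAmin ≤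
        ∑ a ∈ Finset.Icc lo hi, ∑ b ∈ GoodB a, (PatSet a b).card := by
      have h1 : ∀ a ∈ Finset.Icc lo hi, GBmin * NAmin ≤ ∑ b ∈ GoodB a, (PatSet a b).card := by
        intro a ha
        rw [Finset.mem_Icc] at ha
        have h2 : ∀ b ∈ GoodB a, NAmin ≤ (PatSet a b).card := by
          intro b hb
          simp only [GoodB, Finset.mem_filter, Finset.mem_Icc] at hb
          exact (hPat a b ha.1 ha.2 hb.1.1 hb.1.2 hb.2.2.2).1
        calc GBmin * NAmin ≤ (GoodB a).card * NAmin :=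
              Nat.mul_le_mul_right _ (hGoodB a ha.1 ha.2).1
          _ = ∑ _b ∈ GoodB a, NAmin := by rw [Finset.sum_const, smul_eq_mul]
          _ ≤ _ := Finset.sum_le_sum h2
      calc (hi + 1 - lo) * GBmin * NAmin = ∑ _a ∈ Finset.Icc lo hi, GBmin * NAmin := by
            rw [Finset.sum_const, smul_eq_mul, Nat.card_Icc, mul_assoc]
        _ ≤ _ := Finset.sum_le_sum h1
    rw [← hcard] at hsum
    exact hsum.trans hinj
  -- ### fibres: copies with a given corner
  have hfib_sigma : ∀ (c₀ : ℕ) (F : Finset (ℕ × ℕ × ℕ)) (f : ℕ × ℕ × ℕ → (Σ _ : ℕ, ℕ)),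
      (∀ t ∈ F, f t ∈ (GoodB c₀).sigma fun b => PatSet c₀ b) → Set.InjOn f F →
      lo ≤ c₀ → c₀ ≤ hi → F.card ≤ GBmax * NAmax := by
    intro c₀ F f hf hinj hc hc'
    calc F.card ≤ ((GoodB c₀).sigma fun b => PatSet c₀ b).card :=
          Finset.card_le_card_of_injOn f (fun t ht => Finset.mem_coe.mpr (hf t ht)) hinj
      _ = ∑ b ∈ GoodB c₀, (PatSet c₀ b).card := Finset.card_sigma _ _
      _ ≤ ∑ _b ∈ GoodB c₀, NAmax := by
          refine Finset.sum_le_sum fun b hb => ?_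
          simp only [GoodB, Finset.mem_filter, Finset.mem_Icc] at hb
          exact (hPat c₀ b hc hc' hb.1.1 hb.1.2 hb.2.2.2).2
      _ = (GoodB c₀).card * NAmax := by rw [Finset.sum_const, smul_eq_mul]
      _ ≤ GBmax * NAmax := Nat.mul_le_mul_right _ (hGoodB c₀ hc hc').2
  have hfib0 : ∀ c₀, (Cor.filter fun t => t.1 = c₀).card ≤ GBmax * NAmax := by
    intro c₀
    by_cases hc : lo ≤ c₀ ∧ c₀ ≤ hi
    · refine hfib_sigma c₀ _ (fun t => ⟨t.2.2, t.2.1⟩) ?_ ?_ hc.1 hc.2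
      · intro t ht
        rw [Finset.mem_filter] at ht
        obtain ⟨ht, rfl⟩ := ht
        obtain ⟨⟨h0, h1, h2⟩, ⟨w0, w1, w2⟩, ⟨r0, r1, r2⟩⟩ := (hmemCor t).mp ht
        obtain ⟨g0, -, -⟩ := hG3 t ht
        rw [Finset.mem_sigma]
        simp only [GoodB, PatSet, Finset.mem_filter, Finset.mem_Icc]
        exact ⟨⟨h2, w0, r0, g0⟩, h1, w1, w2, r1, r2⟩
      · intro t ht t' ht' heq
        rw [Finset.mem_coe, Finset.mem_filter] at ht ht'
        simp only [Sigma.mk.injEq, heq_eq_eq] at heq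
        exact Prod.ext (ht.2.trans ht'.2.symm) (Prod.ext heq.2 heq.1)
    · have hempty : (Cor.filter fun t => t.1 = c₀) = ∅ := by
        rw [Finset.filter_eq_empty_iff]
        intro t ht heq
        have h0 := ((hmemCor t).mp ht).1.1
        rw [heq] at h0
        exact hc h0
      rw [hempty, Finset.card_empty]
      exact Nat.zero_le _
  have hfib1 : ∀ c₁, (Cor.filter fun t => t.2.1 = c₁).card ≤ GBmax * NAmax := by
    intro c₁
    by_cases hc : lo ≤ c₁ ∧ c₁ ≤ hi
    · refine hfib_sigma c₁ _ (fun t => ⟨t.1, t.2.2⟩) ?_ ?_ hc.1 hc.2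
      · intro t ht
        rw [Finset.mem_filter] at ht
        obtain ⟨ht, rfl⟩ := ht
        obtain ⟨⟨h0, h1, h2⟩, ⟨w0, w1, w2⟩, ⟨r0, r1, r2⟩⟩ := (hmemCor t).mp ht
        obtain ⟨-, g1, -⟩ := hG3 t ht
        rw [Finset.mem_sigma]
        simp only [GoodB, PatSet, Finset.mem_filter, Finset.mem_Icc]
        exact ⟨⟨h0, w1, r1, g1⟩, h2, w2, w0, r2, r0⟩
      · intro t ht t' ht' heq
        rw [Finset.mem_coe, Finset.mem_filter] at ht ht'
        simp only [Sigma.mk.injEq, heq_eq_eq] at heq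
        exact Prod.ext heq.1 (Prod.ext (ht.2.trans ht'.2.symm) heq.2)
    · have hempty : (Cor.filter fun t => t.2.1 = c₁) = ∅ := by
        rw [Finset.filter_eq_empty_iff]
        intro t ht heq
        have h0 := ((hmemCor t).mp ht).1.2.1
        rw [heq] at h0
        exact hc h0
      rw [hempty, Finset.card_empty]
      exact Nat.zero_le _
  have hfib2 : ∀ c₂, (Cor.filter fun t => t.2.2 = c₂).card ≤ GBmax * NAmax := by
    intro c₂
    by_cases hc : lo ≤ c₂ ∧ c₂ ≤ hi
    · refine hfib_sigma c₂ _ (fun t => ⟨t.2.1, t.1⟩) ?_ ?_ hc.1 hc.2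
      · intro t ht
        rw [Finset.mem_filter] at ht
        obtain ⟨ht, rfl⟩ := ht
        obtain ⟨⟨h0, h1, h2⟩, ⟨w0, w1, w2⟩, ⟨r0, r1, r2⟩⟩ := (hmemCor t).mp ht
        obtain ⟨-, -, g2⟩ := hG3 t ht
        rw [Finset.mem_sigma]
        simp only [GoodB, PatSet, Finset.mem_filter, Finset.mem_Icc]
        exact ⟨⟨h1, w2, r2, g2⟩, h0, w0, w1, r0, r1⟩
      · intro t ht t' ht' heq
        rw [Finset.mem_coe, Finset.mem_filter] at ht ht'
        simp only [Sigma.mk.injEq, heq_eq_eq] at heq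
        exact Prod.ext heq.2 (Prod.ext heq.1 (ht.2.trans ht'.2.symm))
    · have hempty : (Cor.filter fun t => t.2.2 = c₂) = ∅ := by
        rw [Finset.filter_eq_empty_iff]
        intro t ht heq
        have h0 := ((hmemCor t).mp ht).1.2.2
        rw [heq] at h0
        exact hc h0
      rw [hempty, Finset.card_empty]
      exact Nat.zero_le _
  -- ### the corner function
  let eC : Fin T ≃ {t // t ∈ Cor} := Cor.equivFin.symm
  let cor : Fin T → Fin 3 → ℕ := fun r => ![(eC r).1.1, (eC r).1.2.1, (eC r).1.2.2]
  have hcor0 : ∀ r, cor r 0 = (eC r).1.1 := fun r => rfl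
  have hcor1 : ∀ r, cor r 1 = (eC r).1.2.1 := fun r => rfl
  have hcor2 : ∀ r, cor r 2 = (eC r).1.2.2 := fun r => rfl
  -- the prong data: range, window, non-extension, compatibility, for each of the three prongs
  have hprong : ∀ r (i : Fin 3), (lo ≤ cor r i ∧ cor r i ≤ hi) ∧ W0 (cor r i) (cor r (i + 2)) ∧
      R0 (cor r i) (cor r (i + 2)) ∧ G3 (cor r i) (cor r (i + 2)) := by
    intro r i
    have ht := (eC r).2
    obtain ⟨⟨h0, h1, h2⟩, ⟨w0, w1, w2⟩, ⟨r0, r1, r2⟩⟩ := (hmemCor _).mp ht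
    obtain ⟨g0, g1, g2⟩ := hG3 _ ht
    fin_cases i
    · exact ⟨h0, w0, r0, g0⟩
    · exact ⟨h1, w1, r1, g1⟩
    · exact ⟨h2, w2, r2, g2⟩
  have hlo' : ∀ r i, ℓ + 1 ≤ cor r i := fun r i => by have := (hprong r i).1.1; omega
  have hhi' : ∀ r i, cor r i + (ℓ + 1) ≤ n := fun r i => by have := (hprong r i).1.2; omega
  -- the window condition in terms of `v`
  have hwin : ∀ r (i : Fin 3) (q : Fin (ℓ + 1)),
      v ⟨cor r (i + 2) + (ℓ - q), by have := hhi' r (i + 2); omega⟩ =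
        ((v ⟨cor r i - (ℓ + 1) + q, by have := hhi' r i; omega⟩).1,
          !(v ⟨cor r i - (ℓ + 1) + q, by have := hhi' r i; omega⟩).2) := by
    intro r i q
    have hW := (hprong r i).2.1 q q.isLt
    have b1 := hhi' r (i + 2)
    have b2 := hhi' r i
    have b3 := hlo' r i
    have hq := q.isLt
    have e1 : cor r (i + 2) + (h - 1 - q) = cor r (i + 2) + (ℓ - q) := by omega
    rw [e1, hvg _ (by omega), hvg _ (by omega)] at hW
    exact hW
  -- ### gluing the prongs by rank along the joint involution
  let site : Fin T × Fin 3 → ℤ × ℤ := fun p => ((cor p.1 p.2 : ℤ), (cor p.1 (p.2 + 2) : ℤ))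
  let σ : ℤ × ℤ → ℤ × ℤ := fun x => (x.2 + h, x.1 - h)
  have hσ : ∀ x, σ (σ x) = x := by
    rintro ⟨x1, x2⟩
    simp only [σ, Prod.mk.injEq]
    constructor <;> ring
  have hfix : ∀ p, σ (site p) ≠ site p := by
    rintro ⟨r, i⟩ heq
    simp only [σ, site, Prod.mk.injEq] at heq
    obtain ⟨e1, -⟩ := heq
    -- `cor r i = cor r (i+2) + h`: the incoming side is its own inverse
    have e2 : cor r i = cor r (i + 2) + h := by exact_mod_cast e1.symm
    have hW := (hprong r i).2.1
    apply not_window_self_inverse vg n h hh1 hred (cor r (i + 2))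
      (by have := hhi' r (i + 2); omega)
    intro q hq
    have e := hW q hq
    rw [e2] at e
    have e3 : cor r (i + 2) + h - h + q = cor r (i + 2) + q := by omega
    rw [e3] at e
    exact e
  obtain ⟨g, hgsymm, hgsite, hgne, hgcount⟩ := exists_rankMatching site σ hσ hfix
  have hgsite' : ∀ p p', g p = some p' →
      cor p.1 p.2 = cor p'.1 (p'.2 + 2) + (ℓ + 1) ∧ cor p'.1 p'.2 = cor p.1 (p.2 + 2) + (ℓ + 1) := by
    intro p p' hgp
    have e := hgsite p p' hgp
    simp only [site, σ, Prod.mk.injEq] at e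
    obtain ⟨e1, e2⟩ := e
    have := hlo' p.1 p.2
    constructor
    · have e3 : ((cor p'.1 (p'.2 + 2) : ℕ) : ℤ) + h = cor p.1 p.2 := by rw [e2]; ring
      exact_mod_cast e3.symm
    · exact_mod_cast e1
  -- ### coverage: incoming sides over a letter
  set N' := 3 * h * (GBmax * NAmax) with hN'
  have hcov : ∀ x : ℕ, (Finset.univ.filter fun p : Fin T × Fin 3 =>
      cor p.1 p.2 - (ℓ + 1) ≤ x ∧ x < cor p.1 p.2).card ≤ N' := by
    intro x
    -- split according to the prong index
    have hsplit : (Finset.univ.filter fun p : Fin T × Fin 3 =>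
        cor p.1 p.2 - (ℓ + 1) ≤ x ∧ x < cor p.1 p.2) ⊆
        (Finset.univ : Finset (Fin 3)).biUnion fun i =>
          (Finset.univ.filter fun r : Fin T => x < cor r i ∧ cor r i ≤ x + h).image
            fun r => (r, i) := by
      rintro ⟨r, i⟩ hp
      rw [Finset.mem_filter] at hp
      obtain ⟨-, h1, h2⟩ := hp
      dsimp only at h1 h2
      rw [Finset.mem_biUnion]
      refine ⟨i, Finset.mem_univ _, Finset.mem_image.mpr ⟨r, ?_, rfl⟩⟩
      rw [Finset.mem_filter]
      have := hlo' r i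
      exact ⟨Finset.mem_univ _, h2, by omega⟩
    -- each prong index contributes at most `h * μ⁺`
    have hper : ∀ i : Fin 3, (Finset.univ.filter fun r : Fin T =>
        x < cor r i ∧ cor r i ≤ x + h).card ≤ h * (GBmax * NAmax) := by
      intro i
      -- pass to `Cor` and slice by the value of the corner
      let coord : Fin 3 → ℕ × ℕ × ℕ → ℕ := fun i t => ![t.1, t.2.1, t.2.2] i
      have hcoord : ∀ r, cor r i = coord i (eC r).1 := by
        intro r
        fin_cases i <;> rfl
      have hfib : ∀ c, (Cor.filter fun t => coord i t = c).card ≤ GBmax * NAmax := by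
        intro c
        fin_cases i
        · exact hfib0 c
        · exact hfib1 c
        · exact hfib2 c
      calc (Finset.univ.filter fun r : Fin T => x < cor r i ∧ cor r i ≤ x + h).card
          ≤ (Cor.filter fun t => x < coord i t ∧ coord i t ≤ x + h).card := by
            refine Finset.card_le_card_of_injOn (fun r => (eC r).1) ?_ ?_
            · intro r hr
              rw [Finset.mem_coe, Finset.mem_filter] at hr
              rw [Finset.mem_coe, Finset.mem_filter, ← hcoord]
              exact ⟨(eC r).2, hr.2⟩
            · intro r _ r' _ heq
              exact eC.injective (Subtype.ext heq)
        _ ≤ ((Finset.Icc (x + 1) (x + h)).biUnion fun c => Cor.filter fun t => coord i t = c).card := by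
            apply Finset.card_le_card
            intro t ht
            rw [Finset.mem_filter] at ht
            rw [Finset.mem_biUnion]
            refine ⟨coord i t, Finset.mem_Icc.mpr ⟨by omega, ht.2.2⟩, ?_⟩
            rw [Finset.mem_filter]
            exact ⟨ht.1, rfl⟩
        _ ≤ ∑ c ∈ Finset.Icc (x + 1) (x + h), (Cor.filter fun t => coord i t = c).card :=
            Finset.card_biUnion_le
        _ ≤ ∑ _c ∈ Finset.Icc (x + 1) (x + h), GBmax * NAmax := Finset.sum_le_sum fun c _ => hfib c
        _ = h * (GBmax * NAmax) := by
            rw [Finset.sum_const, smul_eq_mul, Nat.card_Icc]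
            congr 1
            omega
    calc (Finset.univ.filter fun p : Fin T × Fin 3 =>
          cor p.1 p.2 - (ℓ + 1) ≤ x ∧ x < cor p.1 p.2).card
        ≤ ((Finset.univ : Finset (Fin 3)).biUnion fun i =>
            (Finset.univ.filter fun r : Fin T => x < cor r i ∧ cor r i ≤ x + h).image
              fun r => (r, i)).card := Finset.card_le_card hsplit
      _ ≤ ∑ i : Fin 3, ((Finset.univ.filter fun r : Fin T => x < cor r i ∧ cor r i ≤ x + h).image
              fun r => (r, i)).card := Finset.card_biUnion_le
      _ ≤ ∑ i : Fin 3, h * (GBmax * NAmax) :=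
          Finset.sum_le_sum fun i _ => Finset.card_image_le.trans (hper i)
      _ = N' := by
          rw [Finset.sum_const, smul_eq_mul, Finset.card_univ, Fintype.card_fin, hN']
          ring
  -- ### the assembled bound
  have hmain := four_mul_cl_pow_le_of_gluedTripods v hvc T cor hlo' hhi' hwin g hgsymm hgne
    hgsite' N' hcov
  -- ### the number of unglued prongs
  set Ung := Finset.univ.filter fun p : Fin T × Fin 3 => g p = none with hUng
  have hU3T : Ung.card ≤ 3 * T := by
    have h1 := Finset.card_le_univ Ung
    rw [Fintype.card_prod, Fintype.card_fin, Fintype.card_fin] at h1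
    omega
  -- the fibres of the site map
  let D : ℤ × ℤ → Finset (Fin T × Fin 3) := fun x => Finset.univ.filter fun p => site p = x
  -- (i) upper bound for a fibre: the three prongs at a site `(a, b)` of a copy
  have hD_le : ∀ p₀ : Fin T × Fin 3, (D (site p₀)).card ≤ 3 * NAmax := by
    rintro ⟨r₀, i₀⟩
    set a := cor r₀ i₀ with ha
    set b := cor r₀ (i₀ + 2) with hb
    obtain ⟨⟨halo, hahi⟩, hW, hR, hG⟩ := hprong r₀ i₀
    obtain ⟨⟨hblo, hbhi⟩, -, -, -⟩ := hprong r₀ (i₀ + 2)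
    have hPatb := (hPat a b halo hahi hblo hbhi hG).2
    -- slice the fibre by the prong index
    have hsub : D (site (r₀, i₀)) ⊆ (Finset.univ : Finset (Fin 3)).biUnion fun i =>
        (Finset.univ.filter fun r : Fin T => cor r i = a ∧ cor r (i + 2) = b).image
          fun r => (r, i) := by
      rintro ⟨r, i⟩ hp
      simp only [D, Finset.mem_filter, Finset.mem_univ, true_and, site, Prod.mk.injEq] at hp
      rw [Finset.mem_biUnion]
      refine ⟨i, Finset.mem_univ _, Finset.mem_image.mpr ⟨r, ?_, rfl⟩⟩
      rw [Finset.mem_filter]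
      exact ⟨Finset.mem_univ _, by exact_mod_cast hp.1, by exact_mod_cast hp.2⟩
    -- each slice injects into the free corners over `(a, b)`
    have hs0 : (Finset.univ.filter fun r : Fin T => cor r 0 = a ∧ cor r 2 = b).card ≤ NAmax := by
      refine le_trans ?_ hPatb
      refine Finset.card_le_card_of_injOn (fun r => (eC r).1.2.1) ?_ ?_
      · intro r hr
        rw [Finset.mem_coe, Finset.mem_filter] at hr
        obtain ⟨-, h1, h2⟩ := hr
        rw [hcor0] at h1
        rw [hcor2] at h2
        have e : (eC r).1 = (a, (eC r).1.2.1, b) := Prod.ext h1 (Prod.ext rfl h2)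
        have ht := (eC r).2
        rw [e] at ht
        exact (hmem_acb a b _ halo hahi hblo hbhi hW hR).mp ht
      · intro r hr r' hr' heq
        rw [Finset.mem_coe, Finset.mem_filter] at hr hr'
        rw [hcor0, hcor2] at hr hr'
        apply eC.injective
        apply Subtype.ext
        exact Prod.ext (hr.2.1.trans hr'.2.1.symm) (Prod.ext heq (hr.2.2.trans hr'.2.2.symm))
    have hs1 : (Finset.univ.filter fun r : Fin T => cor r 1 = a ∧ cor r 0 = b).card ≤ NAmax := by
      refine le_trans ?_ hPatb
      refine Finset.card_le_card_of_injOn (fun r => (eC r).1.2.2) ?_ ?_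
      · intro r hr
        rw [Finset.mem_coe, Finset.mem_filter] at hr
        obtain ⟨-, h1, h2⟩ := hr
        rw [hcor1] at h1
        rw [hcor0] at h2
        have ht := (hmemCor _).mp (eC r).2
        rw [h1, h2] at ht
        obtain ⟨⟨-, -, hc⟩, ⟨w0, -, w2⟩, ⟨r0, -, r2⟩⟩ := ht
        rw [Finset.mem_coe]
        simp only [PatSet, Finset.mem_filter, Finset.mem_Icc]
        exact ⟨hc, w2, w0, r2, r0⟩
      · intro r hr r' hr' heq
        rw [Finset.mem_coe, Finset.mem_filter] at hr hr'
        rw [hcor1, hcor0] at hr hr'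
        apply eC.injective
        apply Subtype.ext
        exact Prod.ext (hr.2.2.trans hr'.2.2.symm) (Prod.ext (hr.2.1.trans hr'.2.1.symm) heq)
    have hs2 : (Finset.univ.filter fun r : Fin T => cor r 2 = a ∧ cor r 1 = b).card ≤ NAmax := by
      refine le_trans ?_ hPatb
      refine Finset.card_le_card_of_injOn (fun r => (eC r).1.1) ?_ ?_
      · intro r hr
        rw [Finset.mem_coe, Finset.mem_filter] at hr
        obtain ⟨-, h1, h2⟩ := hr
        rw [hcor2] at h1
        rw [hcor1] at h2
        have ht := (hmemCor _).mp (eC r).2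
        rw [h1, h2] at ht
        obtain ⟨⟨hc, -, -⟩, ⟨w0, w1, -⟩, ⟨r0, r1, -⟩⟩ := ht
        rw [Finset.mem_coe]
        simp only [PatSet, Finset.mem_filter, Finset.mem_Icc]
        exact ⟨hc, w0, w1, r0, r1⟩
      · intro r hr r' hr' heq
        rw [Finset.mem_coe, Finset.mem_filter] at hr hr'
        rw [hcor2, hcor1] at hr hr'
        apply eC.injective
        apply Subtype.ext
        exact Prod.ext heq (Prod.ext (hr.2.2.trans hr'.2.2.symm) (hr.2.1.trans hr'.2.1.symm))
    have hslice : ∀ i : Fin 3, (Finset.univ.filter fun r : Fin T =>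
        cor r i = a ∧ cor r (i + 2) = b).card ≤ NAmax := by
      intro i
      fin_cases i
      · exact hs0
      · exact hs1
      · exact hs2
    calc (D (site (r₀, i₀))).card
        ≤ ((Finset.univ : Finset (Fin 3)).biUnion fun i =>
            (Finset.univ.filter fun r : Fin T => cor r i = a ∧ cor r (i + 2) = b).image
              fun r => (r, i)).card := Finset.card_le_card hsub
      _ ≤ ∑ i : Fin 3, ((Finset.univ.filter fun r : Fin T =>
            cor r i = a ∧ cor r (i + 2) = b).image fun r => (r, i)).card := Finset.card_biUnion_le
      _ ≤ ∑ _i : Fin 3, NAmax :=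
          Finset.sum_le_sum fun i _ => Finset.card_image_le.trans (hslice i)
      _ = 3 * NAmax := by
          rw [Finset.sum_const, smul_eq_mul, Finset.card_univ, Fintype.card_fin]
  -- (ii) lower bound for the partner fibre of an inner site
  have hD_ge : ∀ p₀ : Fin T × Fin 3, cor p₀.1 (p₀.2 + 2) + h ≤ hi → lo + h ≤ cor p₀.1 p₀.2 →
      3 * NAmin ≤ (D (σ (site p₀))).card := by
    rintro ⟨r₀, i₀⟩ hinner1 hinner2
    set a := cor r₀ i₀ with ha
    set b := cor r₀ (i₀ + 2) with hb
    obtain ⟨⟨halo, hahi⟩, hW, hR, hG⟩ := hprong r₀ i₀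
    obtain ⟨⟨hblo, hbhi⟩, -, -, -⟩ := hprong r₀ (i₀ + 2)
    change b + h ≤ hi at hinner1
    change lo + h ≤ a at hinner2
    -- the partner site `(a', b') = (b + h, a - h)` is good and in range
    set a' := b + h with ha'
    set b' := a - h with hb'
    have hW' : W0 a' b' := by
      intro q hq
      have e := hW (h - 1 - q) (by omega)
      have e1 : b + (h - 1 - (h - 1 - q)) = b + q := by omega
      have e2 : a - h + (h - 1 - q) = b' + (h - 1 - q) := by omega
      rw [e1, e2] at e
      have e3 : a' - h + q = b + q := by omega
      rw [e3, (eq_inv_letter_comm _ _).mp e]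
    have hR' : R0 a' b' := by
      have e1 : a' - h - 1 = b - 1 := by omega
      have e2 : b' + h = a := by omega
      show vg (a' - h - 1) ≠ _
      rw [e1, e2]
      intro heq
      exact hG ((eq_inv_letter_comm _ _).mp heq)
    have hG' : G3 a' b' := by
      have e1 : b' - 1 = a - h - 1 := by omega
      show vg a' ≠ _
      rw [e1]
      intro heq
      exact hR ((eq_inv_letter_comm _ _).mp heq)
    have ha'lo : lo ≤ a' := by omega
    have hb'hi : b' ≤ hi := by omega
    have hb'lo : lo ≤ b' := by omega
    have hPat' := (hPat a' b' ha'lo hinner1 hb'lo hb'hi hG').1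
    have hσsite : σ (site (r₀, i₀)) = ((a' : ℤ), (b' : ℤ)) := by
      simp only [σ, site, Prod.mk.injEq]
      constructor
      · push_cast [ha']; ring
      · rw [hb', Nat.cast_sub (by omega)]
    rw [hσsite]
    -- membership of the three permuted triples over a free corner `c`
    have hmem0 : ∀ c, c ∈ PatSet a' b' → (a', c, b') ∈ Cor := fun c hc =>
      (hmem_acb a' b' c ha'lo hinner1 (by omega) hb'hi hW' hR').mpr hc
    have hmem1 : ∀ c, c ∈ PatSet a' b' → (b', a', c) ∈ Cor := by
      intro c hc
      simp only [PatSet, Finset.mem_filter, Finset.mem_Icc] at hc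
      obtain ⟨⟨hclo, hchi⟩, w1, w2, r1, r2⟩ := hc
      rw [hmemCor]
      exact ⟨⟨⟨hb'lo, hb'hi⟩, ⟨ha'lo, hinner1⟩, hclo, hchi⟩, ⟨w2, hW', w1⟩, r2, hR', r1⟩
    have hmem2 : ∀ c, c ∈ PatSet a' b' → (c, b', a') ∈ Cor := by
      intro c hc
      simp only [PatSet, Finset.mem_filter, Finset.mem_Icc] at hc
      obtain ⟨⟨hclo, hchi⟩, w1, w2, r1, r2⟩ := hc
      rw [hmemCor]
      exact ⟨⟨⟨hclo, hchi⟩, ⟨hb'lo, hb'hi⟩, ha'lo, hinner1⟩, ⟨w1, w2, hW'⟩, r1, r2, hR'⟩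
    -- if there is no free corner the bound is trivial
    rcases (PatSet a' b').eq_empty_or_nonempty with hemp | ⟨c₀, hc₀⟩
    · rw [hemp, Finset.card_empty] at hPat'
      omega
    -- three injections with disjoint images (distinguished by the prong index)
    have hinjD : ∀ (i : Fin 3) (tri : ℕ → ℕ × ℕ × ℕ) (hmem : ∀ c, c ∈ PatSet a' b' → tri c ∈ Cor)
        (hinj : ∀ c c', tri c = tri c' → c = c')
        (hsite : ∀ c (hc : c ∈ PatSet a' b'), site (eC.symm ⟨tri c, hmem c hc⟩, i) =
          ((a' : ℤ), (b' : ℤ))),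
        (PatSet a' b').card ≤ ((D ((a' : ℤ), (b' : ℤ))).filter fun p => p.2 = i).card := by
      intro i tri hmem hinj hsite
      refine Finset.card_le_card_of_injOn
        (fun c => if hc : c ∈ PatSet a' b' then (eC.symm ⟨tri c, hmem c hc⟩, i)
          else (eC.symm ⟨tri c₀, hmem c₀ hc₀⟩, i)) ?_ ?_
      · intro c hc
        rw [Finset.mem_coe] at hc
        dsimp only
        rw [dif_pos hc, Finset.mem_coe, Finset.mem_filter]
        simp only [D, Finset.mem_filter, Finset.mem_univ, true_and, and_true]
        exact hsite c hc
      · intro c hc c' hc' heq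
        rw [Finset.mem_coe] at hc hc'
        dsimp only at heq
        rw [dif_pos hc, dif_pos hc'] at heq
        simp only [Prod.mk.injEq, and_true] at heq
        have e := congrArg Subtype.val (eC.symm.injective heq)
        exact hinj c c' e
    have hpart0 := hinjD 0 (fun c => (a', c, b')) hmem0
      (fun c c' e => by simp only [Prod.mk.injEq] at e; exact e.2.1)
      (fun c hc => by
        show (((cor (eC.symm ⟨(a', c, b'), hmem0 c hc⟩) 0 : ℕ) : ℤ),
          ((cor (eC.symm ⟨(a', c, b'), hmem0 c hc⟩) (0 + 2) : ℕ) : ℤ)) = ((a' : ℤ), (b' : ℤ))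
        simp [cor, Equiv.apply_symm_apply])
    have hpart1 := hinjD 1 (fun c => (b', a', c)) hmem1
      (fun c c' e => by simp only [Prod.mk.injEq] at e; exact e.2.2)
      (fun c hc => by
        show (((cor (eC.symm ⟨(b', a', c), hmem1 c hc⟩) 1 : ℕ) : ℤ),
          ((cor (eC.symm ⟨(b', a', c), hmem1 c hc⟩) (1 + 2) : ℕ) : ℤ)) = ((a' : ℤ), (b' : ℤ))
        simp [cor, Equiv.apply_symm_apply])
    have hpart2 := hinjD 2 (fun c => (c, b', a')) hmem2
      (fun c c' e => by simp only [Prod.mk.injEq] at e; exact e.1)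
      (fun c hc => by
        show (((cor (eC.symm ⟨(c, b', a'), hmem2 c hc⟩) 2 : ℕ) : ℤ),
          ((cor (eC.symm ⟨(c, b', a'), hmem2 c hc⟩) (2 + 2) : ℕ) : ℤ)) = ((a' : ℤ), (b' : ℤ))
        simp [cor, Equiv.apply_symm_apply])
    have hpart : ∀ i : Fin 3, (PatSet a' b').card ≤
        ((D ((a' : ℤ), (b' : ℤ))).filter fun p => p.2 = i).card := by
      intro i
      fin_cases i
      · exact hpart0
      · exact hpart1
      · exact hpart2
    have hsumD : ((D ((a' : ℤ), (b' : ℤ)))).card =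
        ∑ i : Fin 3, ((D ((a' : ℤ), (b' : ℤ))).filter fun p => p.2 = i).card :=
      Finset.card_eq_sum_card_fiberwise (f := fun p : Fin T × Fin 3 => p.2)
        (fun _ _ => Finset.mem_univ _)
    rw [hsumD]
    calc 3 * NAmin ≤ 3 * (PatSet a' b').card := Nat.mul_le_mul_left _ hPat'
      _ = ∑ _i : Fin 3, (PatSet a' b').card := by
          rw [Finset.sum_const, smul_eq_mul, Finset.card_univ, Fintype.card_fin]
      _ ≤ _ := Finset.sum_le_sum fun i _ => hpart i
  -- (iii) summing over the sites
  set Img := (Finset.univ : Finset (Fin T × Fin 3)).image site with hImg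
  have hUsum : Ung.card = ∑ x ∈ Img, ((D x).card - (D (σ x)).card) := by
    rw [Finset.card_eq_sum_card_fiberwise (f := site) (t := Img)
      (fun p _ => Finset.mem_image_of_mem site (Finset.mem_univ p))]
    refine Finset.sum_congr rfl fun x _ => ?_
    rw [← hgcount x]
    congr 1
    ext p
    simp only [hUng, Finset.mem_filter, Finset.mem_univ, true_and]
    tauto
  -- the sites as pairs of naturals: all, right boundary, left boundary
  let inner : ℤ × ℤ → Prop := fun x => x.2 + h ≤ hi ∧ (lo : ℤ) + h ≤ x.1
  have hterm : ∀ x ∈ Img, (D x).card - (D (σ x)).card ≤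
      (if inner x then 3 * NAmax - 3 * NAmin else 3 * NAmax) := by
    intro x hx
    rw [hImg, Finset.mem_image] at hx
    obtain ⟨p₀, -, rfl⟩ := hx
    have h1 := hD_le p₀
    split_ifs with hin
    · have hin' : cor p₀.1 (p₀.2 + 2) + h ≤ hi ∧ lo + h ≤ cor p₀.1 p₀.2 := by
        simp only [inner, site] at hin
        constructor
        · exact_mod_cast hin.1
        · exact_mod_cast hin.2
      have h2 := hD_ge p₀ hin'.1 hin'.2
      omega
    · omega
  have hImg_le : Img.card ≤ (hi + 1 - lo) * GBmax := by
    have hsub : Img ⊆ (Finset.Icc lo hi).biUnion fun a =>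
        (GoodB a).image fun b : ℕ => ((a : ℤ), (b : ℤ)) := by
      intro x hx
      rw [hImg, Finset.mem_image] at hx
      obtain ⟨⟨r₀, i₀⟩, -, rfl⟩ := hx
      obtain ⟨⟨halo, hahi⟩, hW, hR, hG⟩ := hprong r₀ i₀
      obtain ⟨⟨hblo, hbhi⟩, -, -, -⟩ := hprong r₀ (i₀ + 2)
      rw [Finset.mem_biUnion]
      refine ⟨cor r₀ i₀, Finset.mem_Icc.mpr ⟨halo, hahi⟩, Finset.mem_image.mpr ⟨cor r₀ (i₀ + 2), ?_, rfl⟩⟩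
      simp only [GoodB, Finset.mem_filter, Finset.mem_Icc]
      exact ⟨⟨hblo, hbhi⟩, hW, hR, hG⟩
    calc Img.card ≤ _ := Finset.card_le_card hsub
      _ ≤ ∑ a ∈ Finset.Icc lo hi, ((GoodB a).image fun b : ℕ => ((a : ℤ), (b : ℤ))).card :=
          Finset.card_biUnion_le
      _ ≤ ∑ _a ∈ Finset.Icc lo hi, GBmax := Finset.sum_le_sum fun a ha =>
          Finset.card_image_le.trans (hGoodB a (Finset.mem_Icc.mp ha).1 (Finset.mem_Icc.mp ha).2).2
      _ = (hi + 1 - lo) * GBmax := by rw [Finset.sum_const, smul_eq_mul, Nat.card_Icc]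
  have hBdR : (Img.filter fun x => (hi : ℤ) < x.2 + h).card ≤ h * GBmax := by
    have hsub : (Img.filter fun x => (hi : ℤ) < x.2 + h) ⊆ (Finset.Icc (max lo (hi - ℓ)) hi).biUnion
        fun b => ((Finset.Icc lo hi).filter fun a => W0 a b ∧ R0 a b ∧ G3 a b).image
          fun a : ℕ => ((a : ℤ), (b : ℤ)) := by
      intro x hx
      rw [Finset.mem_filter, hImg, Finset.mem_image] at hx
      obtain ⟨⟨⟨r₀, i₀⟩, -, rfl⟩, hlt⟩ := hx
      obtain ⟨⟨halo, hahi⟩, hW, hR, hG⟩ := hprong r₀ i₀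
      obtain ⟨⟨hblo, hbhi⟩, -, -, -⟩ := hprong r₀ (i₀ + 2)
      simp only [site] at hlt
      have hlt' : hi < cor r₀ (i₀ + 2) + h := by exact_mod_cast hlt
      rw [Finset.mem_biUnion]
      refine ⟨cor r₀ (i₀ + 2), Finset.mem_Icc.mpr ⟨max_le hblo (by omega), hbhi⟩,
        Finset.mem_image.mpr ⟨cor r₀ i₀, ?_, rfl⟩⟩
      rw [Finset.mem_filter, Finset.mem_Icc]
      exact ⟨⟨halo, hahi⟩, hW, hR, hG⟩
    calc (Img.filter fun x => (hi : ℤ) < x.2 + h).card ≤ _ := Finset.card_le_card hsub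
      _ ≤ ∑ b ∈ Finset.Icc (max lo (hi - ℓ)) hi, (((Finset.Icc lo hi).filter fun a =>
            W0 a b ∧ R0 a b ∧ G3 a b).image fun a : ℕ => ((a : ℤ), (b : ℤ))).card :=
          Finset.card_biUnion_le
      _ ≤ ∑ _b ∈ Finset.Icc (max lo (hi - ℓ)) hi, GBmax := by
          refine Finset.sum_le_sum fun b hb => Finset.card_image_le.trans ?_
          rw [Finset.mem_Icc] at hb
          exact hGoodA b (le_of_max_le_left hb.1) hb.2
      _ = (Finset.Icc (max lo (hi - ℓ)) hi).card * GBmax := by rw [Finset.sum_const, smul_eq_mul]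
      _ ≤ h * GBmax := by
          apply Nat.mul_le_mul_right
          rw [Nat.card_Icc]
          have := le_max_right lo (hi - ℓ)
          omega
  have hBdL : (Img.filter fun x => x.1 < (lo : ℤ) + h).card ≤ h * GBmax := by
    have hsub : (Img.filter fun x => x.1 < (lo : ℤ) + h) ⊆ (Finset.Icc lo (min hi (lo + ℓ))).biUnion
        fun a => (GoodB a).image fun b : ℕ => ((a : ℤ), (b : ℤ)) := by
      intro x hx
      rw [Finset.mem_filter, hImg, Finset.mem_image] at hx
      obtain ⟨⟨⟨r₀, i₀⟩, -, rfl⟩, hlt⟩ := hx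
      obtain ⟨⟨halo, hahi⟩, hW, hR, hG⟩ := hprong r₀ i₀
      obtain ⟨⟨hblo, hbhi⟩, -, -, -⟩ := hprong r₀ (i₀ + 2)
      simp only [site] at hlt
      have hlt' : cor r₀ i₀ < lo + h := by exact_mod_cast hlt
      rw [Finset.mem_biUnion]
      refine ⟨cor r₀ i₀, Finset.mem_Icc.mpr ⟨halo, le_min hahi (by omega)⟩,
        Finset.mem_image.mpr ⟨cor r₀ (i₀ + 2), ?_, rfl⟩⟩
      simp only [GoodB, Finset.mem_filter, Finset.mem_Icc]
      exact ⟨⟨hblo, hbhi⟩, hW, hR, hG⟩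
    calc (Img.filter fun x => x.1 < (lo : ℤ) + h).card ≤ _ := Finset.card_le_card hsub
      _ ≤ ∑ a ∈ Finset.Icc lo (min hi (lo + ℓ)),
            ((GoodB a).image fun b : ℕ => ((a : ℤ), (b : ℤ))).card := Finset.card_biUnion_le
      _ ≤ ∑ _a ∈ Finset.Icc lo (min hi (lo + ℓ)), GBmax := by
          refine Finset.sum_le_sum fun a ha => Finset.card_image_le.trans ?_
          rw [Finset.mem_Icc] at ha
          exact (hGoodB a ha.1 (le_trans ha.2 (min_le_left _ _))).2
      _ = (Finset.Icc lo (min hi (lo + ℓ))).card * GBmax := by rw [Finset.sum_const, smul_eq_mul]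
      _ ≤ h * GBmax := by
          apply Nat.mul_le_mul_right
          rw [Nat.card_Icc]
          have := min_le_right hi (lo + ℓ)
          omega
  have hUup : Ung.card ≤ (hi + 1 - lo) * GBmax * (3 * NAmax - 3 * NAmin) +
      2 * h * GBmax * (3 * NAmax) := by
    rw [hUsum]
    calc ∑ x ∈ Img, ((D x).card - (D (σ x)).card)
        ≤ ∑ x ∈ Img, (if inner x then 3 * NAmax - 3 * NAmin else 3 * NAmax) :=
          Finset.sum_le_sum hterm
      _ = (Img.filter inner).card * (3 * NAmax - 3 * NAmin) +
            (Img.filter fun x => ¬ inner x).card * (3 * NAmax) := by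
          rw [Finset.sum_ite, Finset.sum_const, Finset.sum_const, smul_eq_mul, smul_eq_mul]
      _ ≤ Img.card * (3 * NAmax - 3 * NAmin) +
            ((Img.filter fun x => (hi : ℤ) < x.2 + h).card +
              (Img.filter fun x => x.1 < (lo : ℤ) + h).card) * (3 * NAmax) := by
          apply Nat.add_le_add
          · exact Nat.mul_le_mul_right _ (Finset.card_filter_le _ _)
          · apply Nat.mul_le_mul_right
            calc (Img.filter fun x => ¬ inner x).card
                ≤ ((Img.filter fun x => (hi : ℤ) < x.2 + h) ∪
                    (Img.filter fun x => x.1 < (lo : ℤ) + h)).card := by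
                  apply Finset.card_le_card
                  intro x hx
                  rw [Finset.mem_filter] at hx
                  rw [Finset.mem_union, Finset.mem_filter, Finset.mem_filter]
                  simp only [inner, not_and_or, not_le] at hx
                  rcases hx.2 with h1 | h1
                  · exact Or.inl ⟨hx.1, h1⟩
                  · exact Or.inr ⟨hx.1, h1⟩
              _ ≤ _ := Finset.card_union_le _ _
      _ ≤ (hi + 1 - lo) * GBmax * (3 * NAmax - 3 * NAmin) + 2 * h * GBmax * (3 * NAmax) := by
          apply Nat.add_le_add
          · exact Nat.mul_le_mul_right _ hImg_le
          · have e : 2 * h * GBmax = h * GBmax + h * GBmax := by ring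
            have : (Img.filter fun x => (hi : ℤ) < x.2 + h).card +
                (Img.filter fun x => x.1 < (lo : ℤ) + h).card ≤ 2 * h * GBmax := by
              rw [e]; exact Nat.add_le_add hBdR hBdL
            exact Nat.mul_le_mul_right _ this
  -- ### final arithmetic
  have hsub3 : 3 * NAmax - 3 * NAmin = 3 * qq * (Amax - Amin) := by
    rw [hNAmax, hNAmin, ← Nat.mul_sub, ← Nat.mul_sub]
    ring
  rw [hsub3] at hUup
  have e1 : ℓ * (3 * T - Ung.card) + ℓ * Ung.card = 3 * (ℓ * T) := by
    rw [← Nat.mul_add, Nat.sub_add_cancel hU3T]; ring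
  have e2 : (3 * h - 1) * T = 3 * (ℓ * T) + 2 * T := by
    rw [hh]
    have : 3 * (ℓ + 1) - 1 = 3 * ℓ + 2 := by omega
    rw [this]; ring
  have e3 : (h + 1) * Ung.card = ℓ * Ung.card + 2 * Ung.card := by rw [hh]; ring
  -- monotonicity in `T` and `U`
  have hT' : (3 * h - 1) * ((hi + 1 - lo) * GBmin * NAmin) ≤ (3 * h - 1) * T :=
    Nat.mul_le_mul_left _ hTlow
  have hU' : (h + 1) * Ung.card ≤ (h + 1) * (3 * qq * ((Amax - Amin) * ((hi + 1 - lo) * GBmax) +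
      Amax * (2 * h * GBmax))) := by
    apply Nat.mul_le_mul_left
    refine hUup.trans (le_of_eq ?_)
    rw [hNAmax]; ring
  have hmain' : 4 * commutatorLength (FreeGroup.mk (List.ofFn v) ^ N') + (3 * h - 1) * T ≤
      N' * n + 2 + (h + 1) * Ung.card := by
    rw [e2, e3]
    omega
  calc 4 * commutatorLength (FreeGroup.mk (List.ofFn v) ^ N') +
        (3 * h - 1) * ((hi + 1 - lo) * GBmin * NAmin)
      ≤ 4 * commutatorLength (FreeGroup.mk (List.ofFn v) ^ N') + (3 * h - 1) * T := by omega
    _ ≤ N' * n + 2 + (h + 1) * Ung.card := hmain'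
    _ ≤ _ := by omega

end TripodCounts

end Literature.GroupTheory.CombinatorialGroupTheory
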